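import Literature.RepresentationTheory.KonnoKonno2007.RealUnitaryFixers
import HarnessLib

/-!
# The `KAK` decomposition of `U(α,β)` at arbitrary real rank, I: peeling off one hyperbolic plane — group side, kernel

Topic `RepresentationTheory/KonnoKonno2007`; namespace `Literature.RepresentationTheory.KonnoKonno2007.RealDualPair`.
KERNEL ONLY: one definition with body (`planeVecs`, a set of basis vectors), 0 records, 0 `Prop`-valued definitions,
0 hypotheses; every statement is a kernel fact about the explicit matrix group `UForm α β = U(diag(1_α, −1_β))`
(`RealUnitaryDualPair`), its maximal compact `UForm.kV : U(α) × U(β) →* U(α,β)` and the planar boosts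
`hypV p₀ q₀ t` (`RealUnitaryRankOneKAK`), on top of the stabiliser calculus of `RealUnitaryFixers` (tag `folklore`).

THE INDUCTIVE STEP of the Cartan decomposition `U(α,β) = K · A · K` [Knapp2002, Thm. 7.39] for an arbitrary family of
pairwise disjoint hyperbolic planes `(p j, q j)`, `j ∈ ι` (`p : ι → α`, `q : ι → β` injective).  Write `Fix(T)` for the
fixer of the basis vectors `e_{p j}, e_{q j}`, `j ∈ T` (`fixer α β (planeVecs p q T)`).  **`kak_step`**: for `h ∈ Fix(T)`
and a fresh index `j₁ ∉ T` there are `k, k' ∈ K ∩ Fix(T)`, `s ≥ 0` and `h' ∈ Fix(T ∪ {j₁})` with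
`k · h · k' = a_s^{(p j₁, q j₁)} · h'`.  Proof (no Lie theory, no exponential map):

* §1 for a hermitian matrix `N` which is the identity on the coordinates of `T ⊊ β`: either `N = 1`, or `N` has a unit
  eigenvector supported off `T` with eigenvalue `≠ 1` (`exists_eigenvector_off_or_eq_one`: spectral theorem
  `Matrix.IsHermitian.eigenvectorBasis` for the compression of `N` to the complement of `T`);
* §2 the block identities of `g = (a b; c d) ∈ U(α,β)`: `aᴴa = 1 + cᴴc`, `aᴴb = cᴴd`, `dᴴd = 1 + bᴴb` (from `gᴴJg = J`)
  and `aaᴴ = 1 + bbᴴ`, `acᴴ = bdᴴ`, `ddᴴ = 1 + ccᴴ` (from `gJgᴴ = J`) (`UForm.blocks_rel`, `UForm.blocks_rel'`); the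
  CASE `dᴴd = 1`: then `b = 0`, `c = 0` and `g = kV (a, d) ∈ K` (`exists_eq_kV_of_toBlocks₂₂`);
* §3 entries of `kV (u, w) · g` and `g · kV (u, w)` (`kV_mul_apply_inl/inr`, `mul_kV_apply_inl/inr`);
* §4 **`kak_step_of_eigenvector`** — the CASE of a unit eigenvector `v` of `dᴴd` off `q(T)` with eigenvalue `λ ≠ 1`:
  rotate `v` to `e_{q j₁}` on the right and `d v / ‖d v‖` to `e_{q j₁}` on the left by elements of `U(β)` fixing
  `e_{q(T)}` (`exists_unitaryGroup_col_eq_of_orthogonal`), so that the `q j₁`-column AND the `q j₁`-row of the `d`-block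
  become `cosh s · e_{q j₁}` (`cosh² s = λ`); then rotate the `q j₁`-column of `b` to `−i sinh s · e_{p j₁}` and the
  `q j₁`-row of `c` to `i sinh s · e_{p j₁}` by elements of `U(α)` fixing `e_{p(T)}` (`sinh s > 0` because `λ ≠ 1`).
  The resulting `h₃` has the `q j₁`-column and the `q j₁`-row of `a_s`; hence `h₃ a_s⁻¹` has the unit ROW `e_{q j₁}`, so
  (`UForm.col_eq_of_row_eq`) the unit COLUMN `e_{q j₁}`, which forces the `p j₁`-column of `h₃` to be that of `a_s`
  too; `h' := a_s⁻¹ h₃` fixes `e_{p j₁}`, `e_{q j₁}` and (all factors lying in `Fix(T)`) the old vectors;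
* §5 **`kak_step`**: the dichotomy of §1 for `N = dᴴd` (the identity on `q(T)` for `h ∈ Fix(T)`): `N = 1` is §2
  (`h ∈ K`, take `s = 0`), otherwise §4.

What is NOT here: the assembly over all planes, the product of commuting boosts, properness and the quotient-map
corollaries (sequel `RealUnitaryKAK`).

Provenance (statement shapes only; nothing is cited as a hypothesis): [Knapp2002, Thm. 7.39] (`G = K A K`);
[Helgason1978, Ch. IX, Thm. 1.1].  The matrix proof by singular vectors of the `d`-block is the classical one for
`U(p,q)`/`O(p,q)` (hyperbolic CS decomposition).

BOUNDARY.  Imports only `RealUnitaryFixers` (tree) and Mathlib through it; no record, no `Prop` definition, no cited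
fact; nothing specific to the Hodge/Picard programme.

References: [Knapp2002] A. W. Knapp, *Lie Groups Beyond an Introduction*, 2nd ed., Birkhäuser 2002, Thm. 7.39;
[Helgason1978] S. Helgason, *Differential Geometry, Lie Groups, and Symmetric Spaces*, Academic Press 1978, Ch. IX §1;
[KonnoKonno2007] K. Konno, T. Konno, Kyushu J. Math. 61 (2007), §3.1.
-/

set_option autoImplicit false

noncomputable section

open Matrix Complex
open scoped ComplexConjugate ComplexOrder

namespace Literature.RepresentationTheory.KonnoKonno2007

namespace RealDualPair

open Literature.NumberTheory.Automorphic Literature.NumberTheory.Automorphic.UnitaryGroup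

/-! ## 1. Hermitian matrices which are the identity on a set of coordinates -/

section Hermitian

/-- **dichotomy for a hermitian matrix `N` that is the identity on the coordinates of `T ⊊ n`**: either `N = 1`, or
`N` has a unit eigenvector supported off `T` with a (real) eigenvalue `≠ 1` — the spectral theorem for the compression
of `N` to the coordinates off `T`. [cite: HornJohnson2013, Thm 2.5.6] -/
theorem exists_eigenvector_off_or_eq_one {n : Type*} [Fintype n] [DecidableEq n] (N : Matrix n n ℂ)
    (hN : N.IsHermitian) (T : Finset n) (hT : ∀ b ∈ T, ∀ b', N b' b = (1 : Matrix n n ℂ) b' b) :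
    N = 1 ∨ ∃ (v : n → ℂ) (la : ℝ), (∑ b, ‖v b‖ ^ 2 = 1) ∧ (∀ b ∈ T, v b = 0) ∧ la ≠ 1 ∧
      ∀ b₀, ∑ b', N b₀ b' * v b' = (la : ℂ) * v b₀ := by
  -- rows on `T` are unit rows as well
  have hTr : ∀ b ∈ T, ∀ b', N b b' = (1 : Matrix n n ℂ) b b' := fun b hb b' => by
    rw [← hN.apply b b', hT b hb b']
    by_cases h : b' = b
    · rw [h, Matrix.one_apply_eq, star_one]
    · rw [Matrix.one_apply_ne h, Matrix.one_apply_ne (Ne.symm h), star_zero]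
  -- the compression to the coordinates off `T`
  set N' : Matrix ↥(Tᶜ) ↥(Tᶜ) ℂ := N.submatrix (fun j : ↥(Tᶜ) => (j : n)) (fun j : ↥(Tᶜ) => (j : n)) with hN'def
  have hN' : N'.IsHermitian := hN.submatrix _
  by_cases hall : ∀ i, hN'.eigenvalues i = 1
  · left
    have hN'1 : N' = 1 := by
      rw [hN'.spectral_theorem]
      have hd : diagonal (RCLike.ofReal ∘ hN'.eigenvalues : ↥(Tᶜ) → ℂ) = 1 := by
        rw [← Matrix.diagonal_one]
        congr 1
        funext i
        simp [hall i]
      rw [hd, map_one]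
    ext b b'
    by_cases hb : b ∈ T
    · exact hTr b hb b'
    by_cases hb' : b' ∈ T
    · exact hT b' hb' b
    have e := congrFun (congrFun hN'1 ⟨b, Finset.mem_compl.2 hb⟩) ⟨b', Finset.mem_compl.2 hb'⟩
    rw [hN'def, Matrix.submatrix_apply] at e
    rw [e]
    by_cases hbb : b = b'
    · subst hbb
      rw [Matrix.one_apply_eq, Matrix.one_apply_eq]
    · rw [Matrix.one_apply_ne hbb, Matrix.one_apply_ne fun h => hbb (congrArg Subtype.val h)]
  · right
    push Not at hall
    obtain ⟨i, hi⟩ := hall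
    set v' := hN'.eigenvectorBasis i with hv'
    have hv'1 : ‖v'‖ = 1 := hN'.eigenvectorBasis.orthonormal.1 i
    have hev : N' *ᵥ v'.ofLp = hN'.eigenvalues i • v'.ofLp := hN'.mulVec_eigenvectorBasis i
    have h1 : ∑ j : ↥(Tᶜ), ‖v'.ofLp j‖ ^ 2 = 1 := by
      have h := hv'1
      rw [EuclideanSpace.norm_eq, Real.sqrt_eq_one] at h
      exact h
    refine ⟨fun b => if h : b ∈ Tᶜ then v'.ofLp ⟨b, h⟩ else 0, hN'.eigenvalues i, ?_, ?_, hi, fun b₀ => ?_⟩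
    · beta_reduce
      rw [← Finset.sum_add_sum_compl T, Finset.sum_eq_zero (fun b hb => by
          rw [dif_neg (fun h => Finset.mem_compl.1 h hb), norm_zero, zero_pow two_ne_zero]), zero_add,
        ← Finset.sum_coe_sort, ← h1]
      exact Finset.sum_congr rfl fun j _ => by rw [dif_pos j.2]
    · intro b hb
      exact dif_neg fun h => Finset.mem_compl.1 h hb
    · beta_reduce
      by_cases hb₀ : b₀ ∈ T
      · rw [dif_neg (fun h => Finset.mem_compl.1 h hb₀), mul_zero,
          Finset.sum_congr rfl fun b' _ => by rw [hTr b₀ hb₀ b'], ← Finset.sum_add_sum_compl T,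
          Finset.sum_eq_zero (fun b hb => by rw [dif_neg (fun h => Finset.mem_compl.1 h hb), mul_zero]), zero_add]
        exact Finset.sum_eq_zero fun b hb => by
          rw [Matrix.one_apply_ne (fun h : b₀ = b => Finset.mem_compl.1 hb (h ▸ hb₀)), zero_mul]
      · have e := congrFun hev ⟨b₀, Finset.mem_compl.2 hb₀⟩
        rw [Matrix.mulVec, dotProduct, Pi.smul_apply, Complex.real_smul] at e
        rw [dif_pos (Finset.mem_compl.2 hb₀), ← e, ← Finset.sum_add_sum_compl T,
          Finset.sum_eq_zero (fun b hb => by rw [dif_neg (fun h => Finset.mem_compl.1 h hb), mul_zero]), zero_add,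
          ← Finset.sum_coe_sort]
        exact Finset.sum_congr rfl fun j _ => by rw [dif_pos j.2, hN'def, Matrix.submatrix_apply]

end Hermitian

/-! ## 2. Block identities of `U(α,β)`; the case `dᴴd = 1` -/

section Blocks

variable {α β : Type*} [Fintype α] [DecidableEq α] [Fintype β] [DecidableEq β]

/-- **block identities from `gᴴ J g = J`**: `aᴴa = 1 + cᴴc`, `aᴴb = cᴴd`, `dᴴd = 1 + bᴴb` for `g = (a b; c d) ∈ U(α,β)`.
[cite: Knapp2002, I §1 Example 3] -/
theorem UForm.blocks_rel (g : UForm α β) :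
    ((((g : UForm α β) : GL (α ⊕ β) ℂ) : Matrix (α ⊕ β) (α ⊕ β) ℂ).toBlocks₁₁)ᴴ *
          (((g : UForm α β) : GL (α ⊕ β) ℂ) : Matrix (α ⊕ β) (α ⊕ β) ℂ).toBlocks₁₁ =
        1 + ((((g : UForm α β) : GL (α ⊕ β) ℂ) : Matrix (α ⊕ β) (α ⊕ β) ℂ).toBlocks₂₁)ᴴ *
          (((g : UForm α β) : GL (α ⊕ β) ℂ) : Matrix (α ⊕ β) (α ⊕ β) ℂ).toBlocks₂₁ ∧
      ((((g : UForm α β) : GL (α ⊕ β) ℂ) : Matrix (α ⊕ β) (α ⊕ β) ℂ).toBlocks₁₁)ᴴ *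
          (((g : UForm α β) : GL (α ⊕ β) ℂ) : Matrix (α ⊕ β) (α ⊕ β) ℂ).toBlocks₁₂ =
        ((((g : UForm α β) : GL (α ⊕ β) ℂ) : Matrix (α ⊕ β) (α ⊕ β) ℂ).toBlocks₂₁)ᴴ *
          (((g : UForm α β) : GL (α ⊕ β) ℂ) : Matrix (α ⊕ β) (α ⊕ β) ℂ).toBlocks₂₂ ∧
      ((((g : UForm α β) : GL (α ⊕ β) ℂ) : Matrix (α ⊕ β) (α ⊕ β) ℂ).toBlocks₂₂)ᴴ *
          (((g : UForm α β) : GL (α ⊕ β) ℂ) : Matrix (α ⊕ β) (α ⊕ β) ℂ).toBlocks₂₂ =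
        1 + ((((g : UForm α β) : GL (α ⊕ β) ℂ) : Matrix (α ⊕ β) (α ⊕ β) ℂ).toBlocks₁₂)ᴴ *
          (((g : UForm α β) : GL (α ⊕ β) ℂ) : Matrix (α ⊕ β) (α ⊕ β) ℂ).toBlocks₁₂ := by
  set M := (((g : UForm α β) : GL (α ⊕ β) ℂ) : Matrix (α ⊕ β) (α ⊕ β) ℂ) with hM
  have h1 : Mᴴ * signForm α β * M = signForm α β := (mem_unitaryGroupOfForm_star_iff_conjTranspose _ _).1 g.2
  rw [← Matrix.fromBlocks_toBlocks M, Matrix.fromBlocks_conjTranspose, Matrix.fromBlocks_multiply,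
    Matrix.fromBlocks_multiply] at h1
  change _ = Matrix.fromBlocks 1 0 0 (-1) at h1
  simp only [Matrix.mul_one, Matrix.mul_zero, add_zero, zero_add, Matrix.mul_neg, Matrix.neg_mul] at h1
  obtain ⟨h11, h12, -, h22⟩ := Matrix.fromBlocks_inj.1 h1
  refine ⟨?_, ?_, ?_⟩
  · rw [← h11]; abel
  · rwa [← sub_eq_add_neg, sub_eq_zero] at h12
  · rw [← sub_eq_add_neg, sub_eq_iff_eq_add, neg_add_eq_sub, eq_sub_iff_add_eq] at h22
    rw [← h22]; abel

/-- **block identities from `g J gᴴ = J`**: `aaᴴ = 1 + bbᴴ`, `acᴴ = bdᴴ`, `ddᴴ = 1 + ccᴴ`. [cite: Knapp2002, I §1 Example 3] -/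
theorem UForm.blocks_rel' (g : UForm α β) :
    (((g : UForm α β) : GL (α ⊕ β) ℂ) : Matrix (α ⊕ β) (α ⊕ β) ℂ).toBlocks₁₁ *
          ((((g : UForm α β) : GL (α ⊕ β) ℂ) : Matrix (α ⊕ β) (α ⊕ β) ℂ).toBlocks₁₁)ᴴ =
        1 + (((g : UForm α β) : GL (α ⊕ β) ℂ) : Matrix (α ⊕ β) (α ⊕ β) ℂ).toBlocks₁₂ *
          ((((g : UForm α β) : GL (α ⊕ β) ℂ) : Matrix (α ⊕ β) (α ⊕ β) ℂ).toBlocks₁₂)ᴴ ∧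
      (((g : UForm α β) : GL (α ⊕ β) ℂ) : Matrix (α ⊕ β) (α ⊕ β) ℂ).toBlocks₁₁ *
          ((((g : UForm α β) : GL (α ⊕ β) ℂ) : Matrix (α ⊕ β) (α ⊕ β) ℂ).toBlocks₂₁)ᴴ =
        (((g : UForm α β) : GL (α ⊕ β) ℂ) : Matrix (α ⊕ β) (α ⊕ β) ℂ).toBlocks₁₂ *
          ((((g : UForm α β) : GL (α ⊕ β) ℂ) : Matrix (α ⊕ β) (α ⊕ β) ℂ).toBlocks₂₂)ᴴ ∧
      (((g : UForm α β) : GL (α ⊕ β) ℂ) : Matrix (α ⊕ β) (α ⊕ β) ℂ).toBlocks₂₂ *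
          ((((g : UForm α β) : GL (α ⊕ β) ℂ) : Matrix (α ⊕ β) (α ⊕ β) ℂ).toBlocks₂₂)ᴴ =
        1 + (((g : UForm α β) : GL (α ⊕ β) ℂ) : Matrix (α ⊕ β) (α ⊕ β) ℂ).toBlocks₂₁ *
          ((((g : UForm α β) : GL (α ⊕ β) ℂ) : Matrix (α ⊕ β) (α ⊕ β) ℂ).toBlocks₂₁)ᴴ := by
  set M := (((g : UForm α β) : GL (α ⊕ β) ℂ) : Matrix (α ⊕ β) (α ⊕ β) ℂ) with hM
  have h1 : M * signForm α β * Mᴴ = signForm α β := UForm.mul_signForm_mul_conjTranspose g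
  rw [← Matrix.fromBlocks_toBlocks M, Matrix.fromBlocks_conjTranspose, Matrix.fromBlocks_multiply,
    Matrix.fromBlocks_multiply] at h1
  change _ = Matrix.fromBlocks 1 0 0 (-1) at h1
  simp only [Matrix.mul_one, Matrix.mul_zero, add_zero, zero_add, Matrix.mul_neg, Matrix.neg_mul] at h1
  obtain ⟨h11, h12, -, h22⟩ := Matrix.fromBlocks_inj.1 h1
  refine ⟨?_, ?_, ?_⟩
  · rw [← h11]; abel
  · rwa [← sub_eq_add_neg, sub_eq_zero] at h12
  · rw [← sub_eq_add_neg, sub_eq_iff_eq_add, neg_add_eq_sub, eq_sub_iff_add_eq] at h22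
    rw [← h22]; abel

/-- **the case `dᴴd = 1`: the element is in `K`.**  From `dᴴd = 1 + bᴴb` we get `bᴴb = 0`, so `b = 0`; then
`cᴴd = aᴴb = 0` with `d` unitary gives `c = 0`, and `aᴴa = 1`. [cite: Knapp2002, Thm 7.39] -/
theorem exists_eq_kV_of_toBlocks₂₂ (g : UForm α β)
    (hd : ((((g : UForm α β) : GL (α ⊕ β) ℂ) : Matrix (α ⊕ β) (α ⊕ β) ℂ).toBlocks₂₂)ᴴ *
      (((g : UForm α β) : GL (α ⊕ β) ℂ) : Matrix (α ⊕ β) (α ⊕ β) ℂ).toBlocks₂₂ = 1) :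
    ∃ k : KV α β, g = UForm.kV α β k := by
  set M := (((g : UForm α β) : GL (α ⊕ β) ℂ) : Matrix (α ⊕ β) (α ⊕ β) ℂ) with hM
  obtain ⟨h11, h12, h22⟩ := UForm.blocks_rel g
  simp only [← hM] at h11 h12 h22 hd
  have hb : M.toBlocks₁₂ = 0 := by
    rw [hd, left_eq_add] at h22
    exact Matrix.conjTranspose_mul_self_eq_zero.1 h22
  have hdd : M.toBlocks₂₂ * (M.toBlocks₂₂)ᴴ = 1 := mul_eq_one_comm.1 hd
  have hc : M.toBlocks₂₁ = 0 := by
    rw [hb, Matrix.mul_zero] at h12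
    have h : (M.toBlocks₂₁)ᴴ = 0 := by
      calc (M.toBlocks₂₁)ᴴ = (M.toBlocks₂₁)ᴴ * (M.toBlocks₂₂ * (M.toBlocks₂₂)ᴴ) := by rw [hdd, Matrix.mul_one]
        _ = 0 := by rw [← Matrix.mul_assoc, ← h12, Matrix.zero_mul]
    simpa using congrArg Matrix.conjTranspose h
  have ha : (M.toBlocks₁₁)ᴴ * M.toBlocks₁₁ = 1 := by rw [h11, hc, Matrix.conjTranspose_zero, Matrix.zero_mul, add_zero]
  refine ⟨(⟨M.toBlocks₁₁, Matrix.mem_unitaryGroup_iff'.2 ha⟩, ⟨M.toBlocks₂₂, Matrix.mem_unitaryGroup_iff'.2 hd⟩),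
    Subtype.ext (Units.ext ?_)⟩
  change M = _
  rw [UForm.coe_kV]
  conv_lhs => rw [← Matrix.fromBlocks_toBlocks M, hb, hc]

end Blocks

/-! ## 3. Entries of `kV (u, w) · g` and `g · kV (u, w)` -/

section KVMul

variable {α β : Type*} [Fintype α] [DecidableEq α] [Fintype β] [DecidableEq β]

/-- `(diag(u, w) · g)_{inl a, j} = Σ_{a'} u_{a a'} g_{inl a', j}`. [cite: Knapp2002, Thm 7.39] -/
theorem kV_mul_apply_inl (u : Matrix.unitaryGroup α ℂ) (w : Matrix.unitaryGroup β ℂ) (g : UForm α β) (a : α)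
    (j : α ⊕ β) :
    (((UForm.kV α β (u, w) * g : UForm α β) : GL (α ⊕ β) ℂ) : Matrix (α ⊕ β) (α ⊕ β) ℂ) (Sum.inl a) j =
      ∑ a', (u : Matrix α α ℂ) a a' * (((g : UForm α β) : GL (α ⊕ β) ℂ) : Matrix (α ⊕ β) (α ⊕ β) ℂ) (Sum.inl a') j := by
  rw [UForm.coe_mul, Matrix.mul_apply, Fintype.sum_sum_type]
  simp only [UForm.coe_kV, Matrix.fromBlocks_apply₁₁, Matrix.fromBlocks_apply₁₂, Matrix.zero_apply, zero_mul,
    Finset.sum_const_zero, add_zero]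

/-- `(diag(u, w) · g)_{inr b, j} = Σ_{b'} w_{b b'} g_{inr b', j}`. [cite: Knapp2002, Thm 7.39] -/
theorem kV_mul_apply_inr (u : Matrix.unitaryGroup α ℂ) (w : Matrix.unitaryGroup β ℂ) (g : UForm α β) (b : β)
    (j : α ⊕ β) :
    (((UForm.kV α β (u, w) * g : UForm α β) : GL (α ⊕ β) ℂ) : Matrix (α ⊕ β) (α ⊕ β) ℂ) (Sum.inr b) j =
      ∑ b', (w : Matrix β β ℂ) b b' * (((g : UForm α β) : GL (α ⊕ β) ℂ) : Matrix (α ⊕ β) (α ⊕ β) ℂ) (Sum.inr b') j := by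
  rw [UForm.coe_mul, Matrix.mul_apply, Fintype.sum_sum_type]
  simp only [UForm.coe_kV, Matrix.fromBlocks_apply₂₁, Matrix.fromBlocks_apply₂₂, Matrix.zero_apply, zero_mul,
    Finset.sum_const_zero, zero_add]

/-- `(g · diag(u, w))_{i, inl a} = Σ_{a'} g_{i, inl a'} u_{a' a}`. [cite: Knapp2002, Thm 7.39] -/
theorem mul_kV_apply_inl (g : UForm α β) (u : Matrix.unitaryGroup α ℂ) (w : Matrix.unitaryGroup β ℂ) (i : α ⊕ β)
    (a : α) :
    (((g * UForm.kV α β (u, w) : UForm α β) : GL (α ⊕ β) ℂ) : Matrix (α ⊕ β) (α ⊕ β) ℂ) i (Sum.inl a) =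
      ∑ a', (((g : UForm α β) : GL (α ⊕ β) ℂ) : Matrix (α ⊕ β) (α ⊕ β) ℂ) i (Sum.inl a') * (u : Matrix α α ℂ) a' a := by
  rw [UForm.coe_mul, Matrix.mul_apply, Fintype.sum_sum_type]
  simp only [UForm.coe_kV, Matrix.fromBlocks_apply₁₁, Matrix.fromBlocks_apply₂₁, Matrix.zero_apply, mul_zero,
    Finset.sum_const_zero, add_zero]

/-- `(g · diag(u, w))_{i, inr b} = Σ_{b'} g_{i, inr b'} w_{b' b}`. [cite: Knapp2002, Thm 7.39] -/
theorem mul_kV_apply_inr (g : UForm α β) (u : Matrix.unitaryGroup α ℂ) (w : Matrix.unitaryGroup β ℂ) (i : α ⊕ β)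
    (b : β) :
    (((g * UForm.kV α β (u, w) : UForm α β) : GL (α ⊕ β) ℂ) : Matrix (α ⊕ β) (α ⊕ β) ℂ) i (Sum.inr b) =
      ∑ b', (((g : UForm α β) : GL (α ⊕ β) ℂ) : Matrix (α ⊕ β) (α ⊕ β) ℂ) i (Sum.inr b') * (w : Matrix β β ℂ) b' b := by
  rw [UForm.coe_mul, Matrix.mul_apply, Fintype.sum_sum_type]
  simp only [UForm.coe_kV, Matrix.fromBlocks_apply₁₂, Matrix.fromBlocks_apply₂₂, Matrix.zero_apply, mul_zero,
    Finset.sum_const_zero, zero_add]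

/-- `Σ_{a'} 1_{a a'} f a' = f a`. [cite: HornJohnson2013, 0.2.4] -/
theorem sum_one_apply_mul {n : Type*} [Fintype n] [DecidableEq n] (a : n) (f : n → ℂ) :
    ∑ a', (1 : Matrix n n ℂ) a a' * f a' = f a := by
  rw [Finset.sum_eq_single a (fun a' _ h => by rw [Matrix.one_apply_ne (Ne.symm h), zero_mul])
    (fun h => absurd (Finset.mem_univ a) h), Matrix.one_apply_eq, one_mul]

/-- `Σ_{a'} f a' 1_{a' a} = f a`. [cite: HornJohnson2013, 0.2.4] -/
theorem sum_mul_one_apply {n : Type*} [Fintype n] [DecidableEq n] (a : n) (f : n → ℂ) :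
    ∑ a', f a' * (1 : Matrix n n ℂ) a' a = f a := by
  rw [Finset.sum_eq_single a (fun a' _ h => by rw [Matrix.one_apply_ne h, mul_zero])
    (fun h => absurd (Finset.mem_univ a) h), Matrix.one_apply_eq, mul_one]

/-- **a unit row forces a unit column** (row version of `UForm.row_eq_of_col_eq`, from `g J gᴴ = J`). [cite: Knapp2002, I §1 Example 3] -/
theorem UForm.col_eq_of_row_eq (g : UForm α β) (i₀ : α ⊕ β)
    (h : ∀ j, (((g : UForm α β) : GL (α ⊕ β) ℂ) : Matrix (α ⊕ β) (α ⊕ β) ℂ) i₀ j =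
      (1 : Matrix (α ⊕ β) (α ⊕ β) ℂ) i₀ j) (i : α ⊕ β) :
    (((g : UForm α β) : GL (α ⊕ β) ℂ) : Matrix (α ⊕ β) (α ⊕ β) ℂ) i i₀ = (1 : Matrix (α ⊕ β) (α ⊕ β) ℂ) i i₀ := by
  set M := (((g : UForm α β) : GL (α ⊕ β) ℂ) : Matrix (α ⊕ β) (α ⊕ β) ℂ) with hM
  have h1 : M * signForm α β * Mᴴ = signForm α β := UForm.mul_signForm_mul_conjTranspose g
  have e := congrFun (congrFun h1 i) i₀
  rw [Matrix.mul_assoc, Matrix.mul_apply, signForm_eq_diagonal] at e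
  -- `(J Mᴴ)_{k i₀} = J_{kk} conj(M_{i₀ k}) = J_{kk} δ_{i₀ k}`
  rw [Finset.sum_eq_single i₀ (fun k _ hk => by
      rw [Matrix.diagonal_mul, Matrix.conjTranspose_apply, h k, Matrix.one_apply_ne (Ne.symm hk), star_zero,
        mul_zero, mul_zero]) (fun h' => absurd (Finset.mem_univ i₀) h'), Matrix.diagonal_mul,
    Matrix.conjTranspose_apply, h i₀, Matrix.one_apply_eq, star_one, mul_one, Matrix.diagonal_apply] at e
  have hd : (Sum.elim (fun _ : α => (1 : ℂ)) (fun _ : β => -1)) i₀ ≠ 0 := by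
    rcases i₀ with a | b
    · simp
    · simp
  rw [Matrix.one_apply]
  by_cases hij : i = i₀
  · subst hij
    rw [if_pos rfl] at e ⊢
    exact (mul_eq_right₀ hd).1 e
  · rw [if_neg hij] at e ⊢
    exact (mul_eq_zero.1 e).resolve_right hd

end KVMul

/-! ## 4. The vectors of a family of planes; the step in the presence of a non-trivial singular vector -/

section Step

variable {ι α β : Type*} (p : ι → α) (q : ι → β)

/-- **the basis vectors `e_{p j}`, `e_{q j}` of the planes indexed by `T`.** [cite: Knapp2002, Thm 7.39] -/
def planeVecs (T : Finset ι) : Set (α ⊕ β) := {i | ∃ j ∈ T, i = Sum.inl (p j) ∨ i = Sum.inr (q j)}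

variable {p q}

/-- membership of an `α`-vector. [cite: Knapp2002, Thm 7.39] -/
theorem inl_mem_planeVecs {T : Finset ι} {a : α} : Sum.inl a ∈ planeVecs p q T ↔ ∃ j ∈ T, p j = a := by
  constructor
  · rintro ⟨j, hj, h | h⟩
    · exact ⟨j, hj, (Sum.inl_injective h).symm⟩
    · exact absurd h Sum.inl_ne_inr
  · rintro ⟨j, hj, h⟩
    exact ⟨j, hj, Or.inl (by rw [h])⟩

/-- membership of a `β`-vector. [cite: Knapp2002, Thm 7.39] -/
theorem inr_mem_planeVecs {T : Finset ι} {b : β} : Sum.inr b ∈ planeVecs p q T ↔ ∃ j ∈ T, q j = b := by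
  constructor
  · rintro ⟨j, hj, h | h⟩
    · exact absurd h Sum.inr_ne_inl
    · exact ⟨j, hj, (Sum.inr_injective h).symm⟩
  · rintro ⟨j, hj, h⟩
    exact ⟨j, hj, Or.inr (by rw [h])⟩

/-- the empty family has no vectors. [cite: Knapp2002, Thm 7.39] -/
theorem planeVecs_empty : planeVecs p q (∅ : Finset ι) = ∅ :=
  Set.eq_empty_of_forall_notMem fun _ ⟨_, hj, _⟩ => absurd hj (Finset.notMem_empty _)

/-- inserting a plane adds its two vectors. [cite: Knapp2002, Thm 7.39] -/
theorem mem_planeVecs_insert [DecidableEq ι] {T : Finset ι} {j₁ : ι} {i : α ⊕ β} :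
    i ∈ planeVecs p q (insert j₁ T) ↔ i = Sum.inl (p j₁) ∨ i = Sum.inr (q j₁) ∨ i ∈ planeVecs p q T := by
  constructor
  · rintro ⟨j, hj, h⟩
    rcases Finset.mem_insert.1 hj with rfl | hj
    · rcases h with h | h
      · exact Or.inl h
      · exact Or.inr (Or.inl h)
    · exact Or.inr (Or.inr ⟨j, hj, h⟩)
  · rintro (h | h | ⟨j, hj, h⟩)
    · exact ⟨j₁, Finset.mem_insert_self _ _, Or.inl h⟩
    · exact ⟨j₁, Finset.mem_insert_self _ _, Or.inr h⟩
    · exact ⟨j, Finset.mem_insert_of_mem hj, h⟩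

/-- monotonicity in `T`. [cite: Knapp2002, Thm 7.39] -/
theorem planeVecs_mono {T T' : Finset ι} (h : T ⊆ T') : planeVecs p q T ⊆ planeVecs p q T' :=
  fun _ ⟨j, hj, hi⟩ => ⟨j, h hj, hi⟩

/-- a fresh plane avoids the vectors of `T` (`p`, `q` injective, `j₁ ∉ T`). [cite: Knapp2002, Thm 7.39] -/
theorem inl_notMem_planeVecs (hp : Function.Injective p) {T : Finset ι} {j₁ : ι} (hj₁ : j₁ ∉ T) :
    Sum.inl (p j₁) ∉ planeVecs p q T := fun h => by
  obtain ⟨j, hj, e⟩ := inl_mem_planeVecs.1 h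
  exact hj₁ (hp e ▸ hj)

/-- a fresh plane avoids the vectors of `T` (`p`, `q` injective, `j₁ ∉ T`). [cite: Knapp2002, Thm 7.39] -/
theorem inr_notMem_planeVecs (hq : Function.Injective q) {T : Finset ι} {j₁ : ι} (hj₁ : j₁ ∉ T) :
    Sum.inr (q j₁) ∉ planeVecs p q T := fun h => by
  obtain ⟨j, hj, e⟩ := inr_mem_planeVecs.1 h
  exact hj₁ (hq e ▸ hj)

end Step

/-! ## 5. Peeling off one plane -/

section Peel

variable {ι α β : Type*} [Fintype α] [DecidableEq α] [Fintype β] [DecidableEq β] [DecidableEq ι]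
  {p : ι → α} {q : ι → β}

omit [Fintype α] [Fintype β] in
/-- `1_{inl a, inl a'} = 1_{a a'}`. [cite: HornJohnson2013, 0.2.4] -/
theorem one_apply_inl_inl (a a' : α) :
    (1 : Matrix (α ⊕ β) (α ⊕ β) ℂ) (Sum.inl a) (Sum.inl a') = (1 : Matrix α α ℂ) a a' := by
  by_cases h : a = a'
  · rw [h, Matrix.one_apply_eq, Matrix.one_apply_eq]
  · rw [Matrix.one_apply_ne h, Matrix.one_apply_ne fun h' => h (Sum.inl_injective h')]

omit [Fintype α] [Fintype β] in
/-- `1_{inr b, inr b'} = 1_{b b'}`. [cite: HornJohnson2013, 0.2.4] -/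
theorem one_apply_inr_inr (b b' : β) :
    (1 : Matrix (α ⊕ β) (α ⊕ β) ℂ) (Sum.inr b) (Sum.inr b') = (1 : Matrix β β ℂ) b b' := by
  by_cases h : b = b'
  · rw [h, Matrix.one_apply_eq, Matrix.one_apply_eq]
  · rw [Matrix.one_apply_ne h, Matrix.one_apply_ne fun h' => h (Sum.inr_injective h')]

/-- `Σ_k conj(w_{k i}) w_{k j} = 1_{i j}` for a unitary matrix `w`. [cite: HornJohnson2013, Thm 2.1.4] -/
theorem unitaryGroup_star_mul_self_apply {n : Type*} [Fintype n] [DecidableEq n] (w : Matrix.unitaryGroup n ℂ)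
    (i j : n) : ∑ k, star ((w : Matrix n n ℂ) k i) * (w : Matrix n n ℂ) k j = (1 : Matrix n n ℂ) i j := by
  have e := congrFun (congrFun (Matrix.UnitaryGroup.star_mul_self w) i) j
  rw [Matrix.mul_apply] at e
  exact e

/-- the matrix of `w⁻¹ ∈ U(n)` is `wᴴ`. [cite: HornJohnson2013, Thm 2.1.4] -/
theorem coe_inv_unitaryGroup {n : Type*} [Fintype n] [DecidableEq n] (w : Matrix.unitaryGroup n ℂ) :
    ((w⁻¹ : Matrix.unitaryGroup n ℂ) : Matrix n n ℂ) = star (w : Matrix n n ℂ) := rfl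

/-- **THE STEP, in the presence of a unit eigenvector `v` of `dᴴd` supported off `q(T)` with eigenvalue `λ ≠ 1`**
(`d` the `β`-block of `h ∈ Fix(T)`): there are `k, k' ∈ K ∩ Fix(T)`, `s ≥ 0` and `h' ∈ Fix(T ∪ {j₁})` with
`k · h · k' = a_s · h'`, `a_s` the boost of the fresh plane `(p j₁, q j₁)` with `cosh² s = λ`.  See the module
docstring for the four rotations. [cite: Knapp2002, Thm 7.39] -/
theorem kak_step_of_eigenvector (hp : Function.Injective p) (hq : Function.Injective q) (T : Finset ι) (j₁ : ι)
    (hj₁ : j₁ ∉ T) (h : UForm α β) (hh : h ∈ fixer α β (planeVecs p q T)) (v : β → ℂ) (la : ℝ)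
    (hv1 : ∑ b, ‖v b‖ ^ 2 = 1) (hv0 : ∀ j ∈ T, v (q j) = 0) (hla : la ≠ 1)
    (hev : ∀ b₀, ∑ b, star ((((h : UForm α β) : GL (α ⊕ β) ℂ) : Matrix (α ⊕ β) (α ⊕ β) ℂ) (Sum.inr b) (Sum.inr b₀)) *
      (∑ b', (((h : UForm α β) : GL (α ⊕ β) ℂ) : Matrix (α ⊕ β) (α ⊕ β) ℂ) (Sum.inr b) (Sum.inr b') * v b') = (la : ℂ) * v b₀) :
    ∃ (k k' : KV α β) (s : ℝ) (h' : UForm α β), 0 ≤ s ∧ UForm.kV α β k ∈ fixer α β (planeVecs p q T) ∧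
      UForm.kV α β k' ∈ fixer α β (planeVecs p q T) ∧ h' ∈ fixer α β (planeVecs p q (insert j₁ T)) ∧
      UForm.kV α β k * h * UForm.kV α β k' = hypV (p j₁) (q j₁) s * h' := by
  -- the fresh plane avoids the images of `T`
  have hq₁T : q j₁ ∉ T.image q := fun hm => by
    obtain ⟨j, hj, e⟩ := Finset.mem_image.1 hm
    exact hj₁ (hq e ▸ hj)
  have hp₁T : p j₁ ∉ T.image p := fun hm => by
    obtain ⟨j, hj, e⟩ := Finset.mem_image.1 hm
    exact hj₁ (hp e ▸ hj)
  have himq : ∀ {b}, Sum.inr b ∈ planeVecs p q T → b ∈ T.image q := fun hb => by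
    obtain ⟨j, hj, e⟩ := inr_mem_planeVecs.1 hb
    exact Finset.mem_image.2 ⟨j, hj, e⟩
  have himp : ∀ {a}, Sum.inl a ∈ planeVecs p q T → a ∈ T.image p := fun ha => by
    obtain ⟨j, hj, e⟩ := inl_mem_planeVecs.1 ha
    exact Finset.mem_image.2 ⟨j, hj, e⟩
  -- rows of `h` at the old `β`-vectors; `x = d v` vanishes on `q(T)`
  have hrowq : ∀ j ∈ T, ∀ i, (((h : UForm α β) : GL (α ⊕ β) ℂ) : Matrix (α ⊕ β) (α ⊕ β) ℂ) (Sum.inr (q j)) i = (1 : Matrix (α ⊕ β) (α ⊕ β) ℂ) (Sum.inr (q j)) i :=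
    fun j hj i => row_eq_of_mem_fixer hh (inr_mem_planeVecs.2 ⟨j, hj, rfl⟩) i
  have hx0 : ∀ j ∈ T, (∑ b', (((h : UForm α β) : GL (α ⊕ β) ℂ) : Matrix (α ⊕ β) (α ⊕ β) ℂ) (Sum.inr (q j)) (Sum.inr b') * v b') = 0 := fun j hj => by
    rw [Finset.sum_congr rfl fun b' _ => by rw [hrowq j hj, one_apply_inr_inr], sum_one_apply_mul]
    exact hv0 j hj
  -- `‖x‖² = λ`
  have hxla : ((∑ b, ‖(∑ b', (((h : UForm α β) : GL (α ⊕ β) ℂ) : Matrix (α ⊕ β) (α ⊕ β) ℂ) (Sum.inr b) (Sum.inr b') * v b')‖ ^ 2 : ℝ) : ℂ) = la := by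
    have e1 : ((∑ b, ‖(∑ b', (((h : UForm α β) : GL (α ⊕ β) ℂ) : Matrix (α ⊕ β) (α ⊕ β) ℂ) (Sum.inr b) (Sum.inr b') * v b')‖ ^ 2 : ℝ) : ℂ) = ∑ b, star (∑ b', (((h : UForm α β) : GL (α ⊕ β) ℂ) : Matrix (α ⊕ β) (α ⊕ β) ℂ) (Sum.inr b) (Sum.inr b') * v b') * (∑ b', (((h : UForm α β) : GL (α ⊕ β) ℂ) : Matrix (α ⊕ β) (α ⊕ β) ℂ) (Sum.inr b) (Sum.inr b') * v b') := by
      push_cast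
      exact Finset.sum_congr rfl fun b _ => by rw [Complex.star_def, Complex.conj_mul']
    have e2 : ∀ b, star (∑ b', (((h : UForm α β) : GL (α ⊕ β) ℂ) : Matrix (α ⊕ β) (α ⊕ β) ℂ) (Sum.inr b) (Sum.inr b') * v b') = ∑ b₀, star (v b₀) * star ((((h : UForm α β) : GL (α ⊕ β) ℂ) : Matrix (α ⊕ β) (α ⊕ β) ℂ) (Sum.inr b) (Sum.inr b₀)) := fun b => by
      rw [star_sum]
      exact Finset.sum_congr rfl fun b₀ _ => by rw [star_mul', mul_comm]
    rw [e1, Finset.sum_congr rfl fun b _ => by rw [e2 b, Finset.sum_mul], Finset.sum_comm]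
    have e3 : ∀ b₀, ∑ b, star (v b₀) * star ((((h : UForm α β) : GL (α ⊕ β) ℂ) : Matrix (α ⊕ β) (α ⊕ β) ℂ) (Sum.inr b) (Sum.inr b₀)) * (∑ b', (((h : UForm α β) : GL (α ⊕ β) ℂ) : Matrix (α ⊕ β) (α ⊕ β) ℂ) (Sum.inr b) (Sum.inr b') * v b') =
        star (v b₀) * ((la : ℂ) * v b₀) := fun b₀ => by
      rw [← hev b₀, Finset.mul_sum]
      exact Finset.sum_congr rfl fun b _ => by rw [mul_assoc]
    rw [Finset.sum_congr rfl fun b₀ _ => e3 b₀]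
    have e4 : ∀ b₀, star (v b₀) * ((la : ℂ) * v b₀) = (la : ℂ) * ((‖v b₀‖ ^ 2 : ℝ) : ℂ) := fun b₀ => by
      rw [Complex.ofReal_pow, ← Complex.conj_mul', ← Complex.star_def]; ring
    rw [Finset.sum_congr rfl fun b₀ _ => e4 b₀, ← Finset.mul_sum]
    have e5 : ∑ b₀, ((‖v b₀‖ ^ 2 : ℝ) : ℂ) = 1 := by exact_mod_cast hv1
    rw [e5, mul_one]
  -- `C = cosh s`
  set C : ℝ := Real.sqrt (∑ b, ‖(∑ b', (((h : UForm α β) : GL (α ⊕ β) ℂ) : Matrix (α ⊕ β) (α ⊕ β) ℂ) (Sum.inr b) (Sum.inr b') * v b')‖ ^ 2) with hC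
  have hC0 : 0 ≤ C := Real.sqrt_nonneg _
  have hC2 : C ^ 2 = ∑ b, ‖(∑ b', (((h : UForm α β) : GL (α ⊕ β) ℂ) : Matrix (α ⊕ β) (α ⊕ β) ℂ) (Sum.inr b) (Sum.inr b') * v b')‖ ^ 2 := Real.sq_sqrt (Finset.sum_nonneg fun b _ => sq_nonneg _)
  have hCla : ((C ^ 2 : ℝ) : ℂ) = la := by rw [hC2]; exact hxla
  -- the right rotation `w'`: columns `q(T)` unit, column `q j₁` equal to `v`
  obtain ⟨w', hw'q, hw'T⟩ := exists_unitaryGroup_col_eq_of_orthogonal (T.image q) (q j₁) hq₁T v hv1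
    (fun b hb => by
      obtain ⟨j, hj, e⟩ := Finset.mem_image.1 hb
      rw [← e]
      exact hv0 j hj)
  set h₁ : UForm α β := h * UForm.kV α β (1, w') with hh₁
  have h₁col : ∀ i, (((h₁ : UForm α β) : GL (α ⊕ β) ℂ) : Matrix (α ⊕ β) (α ⊕ β) ℂ) i (Sum.inr (q j₁)) = ∑ b', (((h : UForm α β) : GL (α ⊕ β) ℂ) : Matrix (α ⊕ β) (α ⊕ β) ℂ) i (Sum.inr b') * v b' := fun i => by
    rw [hh₁, mul_kV_apply_inr]
    exact Finset.sum_congr rfl fun b' _ => by rw [hw'q b']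
  -- `‖y‖² = C² − 1`
  have hS2 : ∑ a, ‖(∑ b', (((h : UForm α β) : GL (α ⊕ β) ℂ) : Matrix (α ⊕ β) (α ⊕ β) ℂ) (Sum.inl a) (Sum.inr b') * v b')‖ ^ 2 = C ^ 2 - 1 := by
    have e := UForm.form_apply h₁ (Sum.inr (q j₁)) (Sum.inr (q j₁))
    simp only [h₁col, Matrix.fromBlocks_apply₂₂, Matrix.neg_apply, Matrix.one_apply_eq, Complex.star_def,
      Complex.conj_mul'] at e
    have e' : ((∑ a, ‖(∑ b', (((h : UForm α β) : GL (α ⊕ β) ℂ) : Matrix (α ⊕ β) (α ⊕ β) ℂ) (Sum.inl a) (Sum.inr b') * v b')‖ ^ 2 : ℝ) : ℂ) - ((∑ b, ‖(∑ b', (((h : UForm α β) : GL (α ⊕ β) ℂ) : Matrix (α ⊕ β) (α ⊕ β) ℂ) (Sum.inr b) (Sum.inr b') * v b')‖ ^ 2 : ℝ) : ℂ) = -1 := by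
      push_cast; exact e
    rw [hC2]
    exact_mod_cast (by linear_combination e' :
      ((∑ a, ‖(∑ b', (((h : UForm α β) : GL (α ⊕ β) ℂ) : Matrix (α ⊕ β) (α ⊕ β) ℂ) (Sum.inl a) (Sum.inr b') * v b')‖ ^ 2 : ℝ) : ℂ) = ((∑ b, ‖(∑ b', (((h : UForm α β) : GL (α ⊕ β) ℂ) : Matrix (α ⊕ β) (α ⊕ β) ℂ) (Sum.inr b) (Sum.inr b') * v b')‖ ^ 2 : ℝ) : ℂ) - 1)
  -- `S = sinh s > 0`
  set S : ℝ := Real.sqrt (∑ a, ‖(∑ b', (((h : UForm α β) : GL (α ⊕ β) ℂ) : Matrix (α ⊕ β) (α ⊕ β) ℂ) (Sum.inl a) (Sum.inr b') * v b')‖ ^ 2) with hS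
  have hS0 : 0 ≤ S := Real.sqrt_nonneg _
  have hSsq : S ^ 2 = C ^ 2 - 1 := by rw [hS, Real.sq_sqrt (Finset.sum_nonneg fun a _ => sq_nonneg _), hS2]
  have hSne : S ≠ 0 := fun h0 => by
    have h1 : C ^ 2 = 1 := by nlinarith [hSsq, h0]
    have h2 : (la : ℂ) = 1 := by rw [← hCla, h1]; push_cast; ring
    exact hla (by exact_mod_cast h2)
  have hSne' : (S : ℂ) ≠ 0 := by exact_mod_cast hSne
  have hSpos : 0 < S := lt_of_le_of_ne hS0 (Ne.symm hSne)
  have hCpos : 0 < C := by nlinarith [hSsq, sq_nonneg S, hC0, hSpos]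
  have hCne : (C : ℂ) ≠ 0 := by exact_mod_cast hCpos.ne'
  have hSIne : (S : ℂ) * I ≠ 0 := mul_ne_zero hSne' Complex.I_ne_zero
  set s : ℝ := Real.arsinh S with hs
  have hsinh : Real.sinh s = S := Real.sinh_arsinh S
  have hcosh : Real.cosh s = C := by
    rw [hs, Real.cosh_arsinh, hSsq, show (1 : ℝ) + (C ^ 2 - 1) = C ^ 2 by ring, Real.sqrt_sq hC0]
  have hs0 : 0 ≤ s := Real.arsinh_nonneg_iff.2 hS0
  -- the left rotation `w`: columns `q(T)` unit, column `q j₁` equal to `x / C`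
  obtain ⟨w, hwq, hwT⟩ := exists_unitaryGroup_col_eq_of_orthogonal (T.image q) (q j₁) hq₁T
    (fun b => (C : ℂ)⁻¹ * (∑ b', (((h : UForm α β) : GL (α ⊕ β) ℂ) : Matrix (α ⊕ β) (α ⊕ β) ℂ) (Sum.inr b) (Sum.inr b') * v b'))
    (by
      have e : ∀ b, ‖(C : ℂ)⁻¹ * (∑ b', (((h : UForm α β) : GL (α ⊕ β) ℂ) : Matrix (α ⊕ β) (α ⊕ β) ℂ) (Sum.inr b) (Sum.inr b') * v b')‖ ^ 2 = (C ^ 2)⁻¹ * ‖(∑ b', (((h : UForm α β) : GL (α ⊕ β) ℂ) : Matrix (α ⊕ β) (α ⊕ β) ℂ) (Sum.inr b) (Sum.inr b') * v b')‖ ^ 2 := fun b => by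
        rw [norm_mul, norm_inv, Complex.norm_real, Real.norm_eq_abs, abs_of_nonneg hC0, mul_pow, inv_pow]
      simp_rw [e]
      rw [← Finset.mul_sum, ← hC2]
      exact inv_mul_cancel₀ (pow_ne_zero 2 hCpos.ne'))
    (fun b hb => by
      obtain ⟨j, hj, e⟩ := Finset.mem_image.1 hb
      rw [← e, hx0 j hj, mul_zero])
  have hxw : ∀ b, (∑ b', (((h : UForm α β) : GL (α ⊕ β) ℂ) : Matrix (α ⊕ β) (α ⊕ β) ℂ) (Sum.inr b) (Sum.inr b') * v b') = (C : ℂ) * (w : Matrix β β ℂ) b (q j₁) := fun b => by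
    rw [hwq b, ← mul_assoc, mul_inv_cancel₀ hCne, one_mul]
  set h₂ : UForm α β := UForm.kV α β (1, w⁻¹) * h₁ with hh₂
  -- `h₂ ∈ Fix(T)`
  have hw'fix : UForm.kV α β (1, w') ∈ fixer α β (planeVecs p q T) :=
    kV_one_mem_fixer w' fun b hb b' => hw'T b (himq hb) b'
  have hwfix : UForm.kV α β (1, w⁻¹) ∈ fixer α β (planeVecs p q T) :=
    kV_one_mem_fixer w⁻¹ fun b hb b' => unitaryGroup_inv_col_eq w b (hwT b (himq hb)) b'
  have hh₂fix : h₂ ∈ fixer α β (planeVecs p q T) := Subgroup.mul_mem _ hwfix (Subgroup.mul_mem _ hh hw'fix)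
  -- (F1) the `q j₁`-column of `h₂`
  have hcol_inl : ∀ a, (((h₂ : UForm α β) : GL (α ⊕ β) ℂ) : Matrix (α ⊕ β) (α ⊕ β) ℂ) (Sum.inl a) (Sum.inr (q j₁)) = (∑ b', (((h : UForm α β) : GL (α ⊕ β) ℂ) : Matrix (α ⊕ β) (α ⊕ β) ℂ) (Sum.inl a) (Sum.inr b') * v b') := fun a => by
    rw [hh₂, kV_mul_apply_inl, OneMemClass.coe_one, sum_one_apply_mul, h₁col]
  have hcol_inr : ∀ b, (((h₂ : UForm α β) : GL (α ⊕ β) ℂ) : Matrix (α ⊕ β) (α ⊕ β) ℂ) (Sum.inr b) (Sum.inr (q j₁)) = (C : ℂ) * (1 : Matrix β β ℂ) b (q j₁) := fun b => by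
    rw [hh₂, kV_mul_apply_inr, coe_inv_unitaryGroup,
      Finset.sum_congr rfl fun b' _ => by rw [Matrix.star_apply, h₁col, hxw b'],
      ← unitaryGroup_star_mul_self_apply w, Finset.mul_sum]
    exact Finset.sum_congr rfl fun b' _ => by ring
  -- (F2) the `q j₁`-row of `h₂`, `β`-part
  have hrow_inr : ∀ b, (((h₂ : UForm α β) : GL (α ⊕ β) ℂ) : Matrix (α ⊕ β) (α ⊕ β) ℂ) (Sum.inr (q j₁)) (Sum.inr b) = (C : ℂ) * (1 : Matrix β β ℂ) (q j₁) b := fun b => by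
    rw [hh₂, kV_mul_apply_inr, coe_inv_unitaryGroup]
    have e1 : ∀ b', (((h₁ : UForm α β) : GL (α ⊕ β) ℂ) : Matrix (α ⊕ β) (α ⊕ β) ℂ) (Sum.inr b') (Sum.inr b) =
        ∑ b'', (((h : UForm α β) : GL (α ⊕ β) ℂ) : Matrix (α ⊕ β) (α ⊕ β) ℂ) (Sum.inr b') (Sum.inr b'') * (w' : Matrix β β ℂ) b'' b := fun b' => by
      rw [hh₁, mul_kV_apply_inr]
    rw [Finset.sum_congr rfl fun b' _ => by rw [Matrix.star_apply, e1 b', hwq b', star_mul', Finset.mul_sum],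
      Finset.sum_comm]
    have e2 : ∀ b'', ∑ b', star ((C : ℂ)⁻¹) * star (∑ b₂, (((h : UForm α β) : GL (α ⊕ β) ℂ) : Matrix (α ⊕ β) (α ⊕ β) ℂ) (Sum.inr b') (Sum.inr b₂) * v b₂) *
          ((((h : UForm α β) : GL (α ⊕ β) ℂ) : Matrix (α ⊕ β) (α ⊕ β) ℂ) (Sum.inr b') (Sum.inr b'') * (w' : Matrix β β ℂ) b'' b) =
        star ((C : ℂ)⁻¹) * (w' : Matrix β β ℂ) b'' b *
          star (∑ b', star ((((h : UForm α β) : GL (α ⊕ β) ℂ) : Matrix (α ⊕ β) (α ⊕ β) ℂ) (Sum.inr b') (Sum.inr b'')) * (∑ b₂, (((h : UForm α β) : GL (α ⊕ β) ℂ) : Matrix (α ⊕ β) (α ⊕ β) ℂ) (Sum.inr b') (Sum.inr b₂) * v b₂)) := fun b'' => by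
      rw [star_sum, Finset.mul_sum]
      exact Finset.sum_congr rfl fun b' _ => by rw [star_mul', star_star]; ring
    rw [Finset.sum_congr rfl fun b'' _ => by rw [e2 b'', hev b'', star_mul', ← hw'q b'']]
    have e3 : ∀ b'', star ((C : ℂ)⁻¹) * (w' : Matrix β β ℂ) b'' b *
          (star ((la : ℂ)) * star ((w' : Matrix β β ℂ) b'' (q j₁))) =
        star ((C : ℂ)⁻¹) * star ((la : ℂ)) * (star ((w' : Matrix β β ℂ) b'' (q j₁)) * (w' : Matrix β β ℂ) b'' b) :=
      fun b'' => by ring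
    rw [Finset.sum_congr rfl fun b'' _ => e3 b'', ← Finset.mul_sum, unitaryGroup_star_mul_self_apply w']
    simp only [Complex.star_def, map_inv₀, Complex.conj_ofReal]
    rw [← hCla]
    push_cast
    field_simp
  -- the `q j₁`-row of `h₂`, `α`-part `z`: `‖z‖² = S²`, and `z`, `y` vanish on `p(T)`
  have hz2 : ∑ a, ‖(((h₂ : UForm α β) : GL (α ⊕ β) ℂ) : Matrix (α ⊕ β) (α ⊕ β) ℂ) (Sum.inr (q j₁)) (Sum.inl a)‖ ^ 2 = S ^ 2 := by
    have e := UForm.form_apply_row h₂ (Sum.inr (q j₁)) (Sum.inr (q j₁))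
    have e2 : ∑ b, (((h₂ : UForm α β) : GL (α ⊕ β) ℂ) : Matrix (α ⊕ β) (α ⊕ β) ℂ) (Sum.inr (q j₁)) (Sum.inr b) * star ((((h₂ : UForm α β) : GL (α ⊕ β) ℂ) : Matrix (α ⊕ β) (α ⊕ β) ℂ) (Sum.inr (q j₁)) (Sum.inr b)) = (C : ℂ) * C := by
      rw [Finset.sum_congr rfl fun b _ => by rw [hrow_inr b], Finset.sum_eq_single (q j₁)
        (fun b _ hb => by rw [Matrix.one_apply_ne (Ne.symm hb), mul_zero, zero_mul])
        (fun h' => absurd (Finset.mem_univ _) h'), Matrix.one_apply_eq, mul_one, Complex.star_def,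
        Complex.conj_ofReal]
    rw [e2] at e
    simp only [Matrix.fromBlocks_apply₂₂, Matrix.neg_apply, Matrix.one_apply_eq, Complex.star_def,
      Complex.mul_conj'] at e
    have e' : ((∑ a, ‖(((h₂ : UForm α β) : GL (α ⊕ β) ℂ) : Matrix (α ⊕ β) (α ⊕ β) ℂ) (Sum.inr (q j₁)) (Sum.inl a)‖ ^ 2 : ℝ) : ℂ) = ((C ^ 2 - 1 : ℝ) : ℂ) := by push_cast; linear_combination e
    rw [hSsq]
    exact_mod_cast e'
  have hz0 : ∀ a ∈ T.image p, (((h₂ : UForm α β) : GL (α ⊕ β) ℂ) : Matrix (α ⊕ β) (α ⊕ β) ℂ) (Sum.inr (q j₁)) (Sum.inl a) = 0 := fun a ha => by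
    obtain ⟨j, hj, e⟩ := Finset.mem_image.1 ha
    rw [hh₂fix (Sum.inl a) (inl_mem_planeVecs.2 ⟨j, hj, e⟩) (Sum.inr (q j₁)), Matrix.one_apply_ne Sum.inr_ne_inl]
  have hy0 : ∀ a ∈ T.image p, (∑ b', (((h : UForm α β) : GL (α ⊕ β) ℂ) : Matrix (α ⊕ β) (α ⊕ β) ℂ) (Sum.inl a) (Sum.inr b') * v b') = 0 := fun a ha => by
    obtain ⟨j, hj, e⟩ := Finset.mem_image.1 ha
    rw [← hcol_inl a, row_eq_of_mem_fixer hh₂fix (inl_mem_planeVecs.2 ⟨j, hj, e⟩) (Sum.inr (q j₁)),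
      Matrix.one_apply_ne Sum.inl_ne_inr]
  -- the `α`-rotations `u`, `u'`
  obtain ⟨u, hup, huT⟩ := exists_unitaryGroup_col_eq_of_orthogonal (T.image p) (p j₁) hp₁T
    (fun a => I * (S : ℂ)⁻¹ * (∑ b', (((h : UForm α β) : GL (α ⊕ β) ℂ) : Matrix (α ⊕ β) (α ⊕ β) ℂ) (Sum.inl a) (Sum.inr b') * v b'))
    (by
      have e : ∀ a, ‖I * (S : ℂ)⁻¹ * (∑ b', (((h : UForm α β) : GL (α ⊕ β) ℂ) : Matrix (α ⊕ β) (α ⊕ β) ℂ) (Sum.inl a) (Sum.inr b') * v b')‖ ^ 2 = (S ^ 2)⁻¹ * ‖(∑ b', (((h : UForm α β) : GL (α ⊕ β) ℂ) : Matrix (α ⊕ β) (α ⊕ β) ℂ) (Sum.inl a) (Sum.inr b') * v b')‖ ^ 2 := fun a => by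
        rw [norm_mul, norm_mul, Complex.norm_I, one_mul, norm_inv, Complex.norm_real, Real.norm_eq_abs,
          abs_of_nonneg hS0, mul_pow, inv_pow]
      simp_rw [e]
      rw [← Finset.mul_sum, hS2, ← hSsq]
      exact inv_mul_cancel₀ (pow_ne_zero 2 hSne))
    (fun a ha => by rw [hy0 a ha, mul_zero])
  obtain ⟨u', hu'p, hu'T⟩ := exists_unitaryGroup_col_eq_of_orthogonal (T.image p) (p j₁) hp₁T
    (fun a => I * (S : ℂ)⁻¹ * star ((((h₂ : UForm α β) : GL (α ⊕ β) ℂ) : Matrix (α ⊕ β) (α ⊕ β) ℂ) (Sum.inr (q j₁)) (Sum.inl a)))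
    (by
      have e : ∀ a, ‖I * (S : ℂ)⁻¹ * star ((((h₂ : UForm α β) : GL (α ⊕ β) ℂ) : Matrix (α ⊕ β) (α ⊕ β) ℂ) (Sum.inr (q j₁)) (Sum.inl a))‖ ^ 2 = (S ^ 2)⁻¹ * ‖(((h₂ : UForm α β) : GL (α ⊕ β) ℂ) : Matrix (α ⊕ β) (α ⊕ β) ℂ) (Sum.inr (q j₁)) (Sum.inl a)‖ ^ 2 := fun a => by
        rw [norm_mul, norm_mul, Complex.norm_I, one_mul, norm_inv, Complex.norm_real, Real.norm_eq_abs,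
          abs_of_nonneg hS0, norm_star, mul_pow, inv_pow]
      simp_rw [e]
      rw [← Finset.mul_sum, hz2]
      exact inv_mul_cancel₀ (pow_ne_zero 2 hSne))
    (fun a ha => by rw [hz0 a ha, star_zero, mul_zero])
  have hyu : ∀ a, (∑ b', (((h : UForm α β) : GL (α ⊕ β) ℂ) : Matrix (α ⊕ β) (α ⊕ β) ℂ) (Sum.inl a) (Sum.inr b') * v b') = -((S : ℂ) * I) * (u : Matrix α α ℂ) a (p j₁) := fun a => by
    rw [hup a, show -((S : ℂ) * I) * (I * (S : ℂ)⁻¹ * (∑ b', (((h : UForm α β) : GL (α ⊕ β) ℂ) : Matrix (α ⊕ β) (α ⊕ β) ℂ) (Sum.inl a) (Sum.inr b') * v b')) =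
      -(((S : ℂ) * (S : ℂ)⁻¹) * (I * I)) * (∑ b', (((h : UForm α β) : GL (α ⊕ β) ℂ) : Matrix (α ⊕ β) (α ⊕ β) ℂ) (Sum.inl a) (Sum.inr b') * v b') by ring, mul_inv_cancel₀ hSne', Complex.I_mul_I]
    ring
  have hzu' : ∀ a, (((h₂ : UForm α β) : GL (α ⊕ β) ℂ) : Matrix (α ⊕ β) (α ⊕ β) ℂ) (Sum.inr (q j₁)) (Sum.inl a) = (S : ℂ) * I * star ((u' : Matrix α α ℂ) a (p j₁)) := fun a => by
    rw [hu'p a, star_mul', star_mul', star_star]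
    simp only [Complex.star_def, Complex.conj_I, map_inv₀, Complex.conj_ofReal]
    rw [show (S : ℂ) * I * (-I * ((S : ℂ))⁻¹ * (((h₂ : UForm α β) : GL (α ⊕ β) ℂ) : Matrix (α ⊕ β) (α ⊕ β) ℂ) (Sum.inr (q j₁)) (Sum.inl a)) =
        (((S : ℂ) * (S : ℂ)⁻¹) * -(I * I)) * (((h₂ : UForm α β) : GL (α ⊕ β) ℂ) : Matrix (α ⊕ β) (α ⊕ β) ℂ) (Sum.inr (q j₁)) (Sum.inl a) by ring, mul_inv_cancel₀ hSne', Complex.I_mul_I]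
    ring
  set h₃ : UForm α β := UForm.kV α β (u⁻¹, 1) * h₂ * UForm.kV α β (u', 1) with hh₃
  have hufix : UForm.kV α β (u⁻¹, 1) ∈ fixer α β (planeVecs p q T) :=
    kV_mem_fixer_one u⁻¹ fun a ha a' => unitaryGroup_inv_col_eq u a (huT a (himp ha)) a'
  have hu'fix : UForm.kV α β (u', 1) ∈ fixer α β (planeVecs p q T) :=
    kV_mem_fixer_one u' fun a ha a' => hu'T a (himp ha) a'
  have hh₃fix : h₃ ∈ fixer α β (planeVecs p q T) := Subgroup.mul_mem _ (Subgroup.mul_mem _ hufix hh₂fix) hu'fix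
  -- (G1) the `q j₁`-column of `h₃` is that of `a_s`
  have hG1 : ∀ i, (((h₃ : UForm α β) : GL (α ⊕ β) ℂ) : Matrix (α ⊕ β) (α ⊕ β) ℂ) i (Sum.inr (q j₁)) = (((hypV (p j₁) (q j₁) s : UForm α β) : GL (α ⊕ β) ℂ) : Matrix (α ⊕ β) (α ⊕ β) ℂ) i (Sum.inr (q j₁)) := by
    have e0 : ∀ i, (((h₃ : UForm α β) : GL (α ⊕ β) ℂ) : Matrix (α ⊕ β) (α ⊕ β) ℂ) i (Sum.inr (q j₁)) =
        (((UForm.kV α β (u⁻¹, 1) * h₂ : UForm α β) : GL (α ⊕ β) ℂ) : Matrix (α ⊕ β) (α ⊕ β) ℂ) i (Sum.inr (q j₁)) := fun i => by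
      rw [hh₃, mul_kV_apply_inr, OneMemClass.coe_one, sum_mul_one_apply]
    rintro (a | b)
    · rw [e0, kV_mul_apply_inl, coe_inv_unitaryGroup, Finset.sum_congr rfl fun a' _ => by
        rw [Matrix.star_apply, hcol_inl, hyu a'], hypV_inl_inr]
      have e1 : ∑ a', star ((u : Matrix α α ℂ) a' a) * (-((S : ℂ) * I) * (u : Matrix α α ℂ) a' (p j₁)) =
          -((S : ℂ) * I) * (1 : Matrix α α ℂ) a (p j₁) := by
        rw [← unitaryGroup_star_mul_self_apply u, Finset.mul_sum]
        exact Finset.sum_congr rfl fun a' _ => by ring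
      rw [e1, hsinh]
      by_cases ha : a = p j₁
      · rw [if_pos ⟨ha, rfl⟩, ha, Matrix.one_apply_eq]; ring
      · rw [if_neg (fun h' => ha h'.1), Matrix.one_apply_ne ha, mul_zero]
    · rw [e0, kV_mul_apply_inr, OneMemClass.coe_one, sum_one_apply_mul, hcol_inr, hypV_inr_inr, hcosh]
      by_cases hb : b = q j₁
      · rw [if_pos hb, if_pos rfl, hb, Matrix.one_apply_eq, mul_one]
      · rw [if_neg hb, if_neg (Ne.symm hb), Matrix.one_apply_ne hb, mul_zero]
  -- (G2) the `q j₁`-row of `h₃` is that of `a_s`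
  have hG2 : ∀ j, (((h₃ : UForm α β) : GL (α ⊕ β) ℂ) : Matrix (α ⊕ β) (α ⊕ β) ℂ) (Sum.inr (q j₁)) j = (((hypV (p j₁) (q j₁) s : UForm α β) : GL (α ⊕ β) ℂ) : Matrix (α ⊕ β) (α ⊕ β) ℂ) (Sum.inr (q j₁)) j := by
    have e0 : ∀ k, (((UForm.kV α β (u⁻¹, 1) * h₂ : UForm α β) : GL (α ⊕ β) ℂ) : Matrix (α ⊕ β) (α ⊕ β) ℂ) (Sum.inr (q j₁)) k = (((h₂ : UForm α β) : GL (α ⊕ β) ℂ) : Matrix (α ⊕ β) (α ⊕ β) ℂ) (Sum.inr (q j₁)) k := fun k => by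
      rw [kV_mul_apply_inr, OneMemClass.coe_one, sum_one_apply_mul]
    rintro (a' | b)
    · rw [hh₃, mul_kV_apply_inl, Finset.sum_congr rfl fun a _ => by rw [e0, hzu' a, mul_assoc], ← Finset.mul_sum,
        unitaryGroup_star_mul_self_apply u', hypV_inr_inl, hsinh]
      by_cases ha : a' = p j₁
      · rw [if_pos ⟨rfl, ha⟩, ha, Matrix.one_apply_eq]; ring
      · rw [if_neg (fun h' => ha h'.2), Matrix.one_apply_ne (Ne.symm ha), mul_zero]
    · rw [hh₃, mul_kV_apply_inr, OneMemClass.coe_one, sum_mul_one_apply, e0, hrow_inr, hypV_inr_inr, if_pos rfl,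
        hcosh]
      by_cases hb : b = q j₁
      · rw [if_pos hb, hb, Matrix.one_apply_eq, mul_one]
      · rw [if_neg hb, Matrix.one_apply_ne (Ne.symm hb), mul_zero]
  -- expansion of a product with `a_{−s}` at the `q j₁`-column
  have hexp : ∀ g : UForm α β, ∀ i, (((g * hypV (p j₁) (q j₁) (-s) : UForm α β) : GL (α ⊕ β) ℂ) : Matrix (α ⊕ β) (α ⊕ β) ℂ) i (Sum.inr (q j₁)) =
      (((g : UForm α β) : GL (α ⊕ β) ℂ) : Matrix (α ⊕ β) (α ⊕ β) ℂ) i (Sum.inl (p j₁)) * ((S : ℂ) * I) + (((g : UForm α β) : GL (α ⊕ β) ℂ) : Matrix (α ⊕ β) (α ⊕ β) ℂ) i (Sum.inr (q j₁)) * (C : ℂ) := fun g i => by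
    rw [UForm.coe_mul, Matrix.mul_apply, Fintype.sum_sum_type]
    congr 1
    · rw [Finset.sum_eq_single (p j₁) (fun a _ ha => by rw [hypV_inl_inr, if_neg (fun h' => ha h'.1), mul_zero])
        (fun h' => absurd (Finset.mem_univ _) h'), hypV_inl_inr, if_pos ⟨rfl, rfl⟩, Real.sinh_neg, hsinh]
      push_cast
      ring
    · rw [Finset.sum_eq_single (q j₁) (fun b _ hb => by
          rw [hypV_inr_inr, if_neg hb, if_neg (Ne.symm hb), mul_zero])
        (fun h' => absurd (Finset.mem_univ _) h'), hypV_inr_inr, if_pos rfl, if_pos rfl, Real.cosh_neg, hcosh]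
  have hAA : ∀ i j, (((hypV (p j₁) (q j₁) s * hypV (p j₁) (q j₁) (-s) : UForm α β) : GL (α ⊕ β) ℂ) : Matrix (α ⊕ β) (α ⊕ β) ℂ) i j =
      (1 : Matrix (α ⊕ β) (α ⊕ β) ℂ) i j := fun i j => by
    rw [← hypV_add, add_neg_cancel, hypV_zero, UForm.coe_one]
  have hAA' : ∀ i j, (((hypV (p j₁) (q j₁) (-s) * hypV (p j₁) (q j₁) s : UForm α β) : GL (α ⊕ β) ℂ) : Matrix (α ⊕ β) (α ⊕ β) ℂ) i j =
      (1 : Matrix (α ⊕ β) (α ⊕ β) ℂ) i j := fun i j => by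
    rw [← hypV_add, neg_add_cancel, hypV_zero, UForm.coe_one]
  -- (G3) the `p j₁`-column of `h₃` is that of `a_s`
  have hG3 : ∀ i, (((h₃ : UForm α β) : GL (α ⊕ β) ℂ) : Matrix (α ⊕ β) (α ⊕ β) ℂ) i (Sum.inl (p j₁)) = (((hypV (p j₁) (q j₁) s : UForm α β) : GL (α ⊕ β) ℂ) : Matrix (α ⊕ β) (α ⊕ β) ℂ) i (Sum.inl (p j₁)) := by
    -- the row `q j₁` of `h₃ a_{−s}` is a unit row, hence so is its column `q j₁`
    have hrowX : ∀ j, (((h₃ * hypV (p j₁) (q j₁) (-s) : UForm α β) : GL (α ⊕ β) ℂ) : Matrix (α ⊕ β) (α ⊕ β) ℂ) (Sum.inr (q j₁)) j =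
        (1 : Matrix (α ⊕ β) (α ⊕ β) ℂ) (Sum.inr (q j₁)) j := fun j => by
      rw [UForm.coe_mul, Matrix.mul_apply, Finset.sum_congr rfl fun k _ => by rw [hG2 k], ← Matrix.mul_apply,
        ← UForm.coe_mul, hAA]
    have hcolX := UForm.col_eq_of_row_eq _ _ hrowX
    intro i
    have e1 := hcolX i
    have e2 := hAA i (Sum.inr (q j₁))
    rw [hexp, hG1 i] at e1
    rw [hexp] at e2
    have e3 : ((((h₃ : UForm α β) : GL (α ⊕ β) ℂ) : Matrix (α ⊕ β) (α ⊕ β) ℂ) i (Sum.inl (p j₁)) - (((hypV (p j₁) (q j₁) s : UForm α β) : GL (α ⊕ β) ℂ) : Matrix (α ⊕ β) (α ⊕ β) ℂ) i (Sum.inl (p j₁))) * ((S : ℂ) * I) = 0 := by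
      linear_combination e1 - e2
    exact sub_eq_zero.1 ((mul_eq_zero.1 e3).resolve_right hSIne)
  -- the new residual `h' = a_{−s} h₃`
  have hk : UForm.kV α β (u⁻¹, w⁻¹) = UForm.kV α β (u⁻¹, 1) * UForm.kV α β (1, w⁻¹) := by
    rw [← map_mul, Prod.mk_mul_mk, mul_one, one_mul]
  have hk' : UForm.kV α β (u', w') = UForm.kV α β (1, w') * UForm.kV α β (u', 1) := by
    rw [← map_mul, Prod.mk_mul_mk, one_mul, mul_one]
  refine ⟨(u⁻¹, w⁻¹), (u', w'), s, hypV (p j₁) (q j₁) (-s) * h₃, hs0, ?_, ?_, ?_, ?_⟩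
  · exact kV_mem_fixer u⁻¹ w⁻¹ (fun a ha a' => unitaryGroup_inv_col_eq u a (huT a (himp ha)) a')
      fun b hb b' => unitaryGroup_inv_col_eq w b (hwT b (himq hb)) b'
  · exact kV_mem_fixer u' w' (fun a ha a' => hu'T a (himp ha) a') fun b hb b' => hw'T b (himq hb) b'
  · intro i₀ hi₀ i
    rcases mem_planeVecs_insert.1 hi₀ with rfl | rfl | hi₀
    · rw [UForm.coe_mul, Matrix.mul_apply, Finset.sum_congr rfl fun k _ => by rw [hG3 k], ← Matrix.mul_apply,
        ← UForm.coe_mul, hAA']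
    · rw [UForm.coe_mul, Matrix.mul_apply, Finset.sum_congr rfl fun k _ => by rw [hG1 k], ← Matrix.mul_apply,
        ← UForm.coe_mul, hAA']
    · exact Subgroup.mul_mem _ (hypV_mem_fixer (p j₁) (q j₁) (inl_notMem_planeVecs hp hj₁)
        (inr_notMem_planeVecs hq hj₁) (-s)) hh₃fix i₀ hi₀ i
  · rw [← mul_assoc, ← hypV_add, add_neg_cancel, hypV_zero, one_mul, hk, hk', hh₃, hh₂, hh₁]
    simp only [mul_assoc]

/-- **THE INDUCTIVE STEP of `KAK`**: for `h ∈ Fix(T)` and a fresh index `j₁ ∉ T` there are `k, k' ∈ K ∩ Fix(T)`,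
`s ≥ 0` and `h' ∈ Fix(T ∪ {j₁})` with `k · h · k' = a_s^{(p j₁, q j₁)} · h'`.  Dichotomy on `N = dᴴd` (hermitian, the
identity on `q(T)`): `N = 1` puts `h` in `K` (`exists_eq_kV_of_toBlocks₂₂`; take `s = 0`), otherwise
`kak_step_of_eigenvector`. [cite: Knapp2002, Thm 7.39] -/
theorem kak_step (hp : Function.Injective p) (hq : Function.Injective q) (T : Finset ι) (j₁ : ι) (hj₁ : j₁ ∉ T)
    (h : UForm α β) (hh : h ∈ fixer α β (planeVecs p q T)) :
    ∃ (k k' : KV α β) (s : ℝ) (h' : UForm α β), 0 ≤ s ∧ UForm.kV α β k ∈ fixer α β (planeVecs p q T) ∧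
      UForm.kV α β k' ∈ fixer α β (planeVecs p q T) ∧ h' ∈ fixer α β (planeVecs p q (insert j₁ T)) ∧
      UForm.kV α β k * h * UForm.kV α β k' = hypV (p j₁) (q j₁) s * h' := by
  set N : Matrix β β ℂ := ((((h : UForm α β) : GL (α ⊕ β) ℂ) : Matrix (α ⊕ β) (α ⊕ β) ℂ).toBlocks₂₂)ᴴ * (((h : UForm α β) : GL (α ⊕ β) ℂ) : Matrix (α ⊕ β) (α ⊕ β) ℂ).toBlocks₂₂ with hNdef
  have hN : N.IsHermitian := Matrix.isHermitian_conjTranspose_mul_self _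
  have hNapply : ∀ b b', N b b' = ∑ b₀, star ((((h : UForm α β) : GL (α ⊕ β) ℂ) : Matrix (α ⊕ β) (α ⊕ β) ℂ) (Sum.inr b₀) (Sum.inr b)) * (((h : UForm α β) : GL (α ⊕ β) ℂ) : Matrix (α ⊕ β) (α ⊕ β) ℂ) (Sum.inr b₀) (Sum.inr b') :=
    fun b b' => by
      rw [hNdef, Matrix.mul_apply]
      rfl
  have hNT : ∀ b ∈ T.image q, ∀ b', N b' b = (1 : Matrix β β ℂ) b' b := fun b hb b' => by
    obtain ⟨j, hj, rfl⟩ := Finset.mem_image.1 hb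
    have hc : ∀ i, (((h : UForm α β) : GL (α ⊕ β) ℂ) : Matrix (α ⊕ β) (α ⊕ β) ℂ) i (Sum.inr (q j)) = (1 : Matrix (α ⊕ β) (α ⊕ β) ℂ) i (Sum.inr (q j)) :=
      hh _ (inr_mem_planeVecs.2 ⟨j, hj, rfl⟩)
    rw [hNapply, Finset.sum_congr rfl fun b₀ _ => by rw [hc, one_apply_inr_inr], sum_mul_one_apply,
      row_eq_of_mem_fixer hh (inr_mem_planeVecs.2 ⟨j, hj, rfl⟩), one_apply_inr_inr]
    by_cases hb' : b' = q j
    · rw [hb', Matrix.one_apply_eq, star_one]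
    · rw [Matrix.one_apply_ne hb', Matrix.one_apply_ne (Ne.symm hb'), star_zero]
  rcases exists_eigenvector_off_or_eq_one N hN (T.image q) hNT with hN1 | ⟨v, la, hv1, hv0, hla, hev⟩
  · -- `dᴴd = 1`: `h ∈ K`
    obtain ⟨k, hk⟩ := exists_eq_kV_of_toBlocks₂₂ h hN1
    refine ⟨1, k⁻¹, 0, 1, le_rfl, by rw [map_one]; exact Subgroup.one_mem _, ?_, Subgroup.one_mem _, ?_⟩
    · rw [map_inv, ← hk]
      exact Subgroup.inv_mem _ hh
    · rw [map_one, one_mul, hk, ← map_mul, mul_inv_cancel, map_one, hypV_zero, one_mul]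
  · -- a non-trivial singular vector
    refine kak_step_of_eigenvector hp hq T j₁ hj₁ h hh v la hv1
      (fun j hj => hv0 (q j) (Finset.mem_image.2 ⟨j, hj, rfl⟩)) hla fun b₀ => ?_
    rw [← hev b₀]
    symm
    rw [Finset.sum_congr rfl fun b' _ => by rw [hNapply, Finset.sum_mul], Finset.sum_comm]
    refine Finset.sum_congr rfl fun b _ => ?_
    rw [Finset.mul_sum]
    exact Finset.sum_congr rfl fun b' _ => by rw [mul_assoc]

end Peel

end RealDualPair

end Literature.RepresentationTheory.KonnoKonno2007

end

-- buildfix 2026-08-21 (ops-buildfix-2): comment-only re-land to re-queue the hub build of this module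
-- (accepted 06:40-07:30Z but never dispatched to the build lane, HOME LEDGER G11b-3); no declaration changed.
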